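import Literature.IUT.HodgeTheaters.FPrimeStrips

/-!
# [IUTchI] Remark 5.2.1 (i) / Definition 4.1 (iv): functoriality laws of `𝔉^⊢ ↦ 𝔇^⊢` and `𝔇 ↦ 𝔇^⊢` — laws kit over `FKit`

Mochizuki, *Inter-universal Teichmüller theory I*, kurims manuscript (May 2020): Remark 5.2.1 (i)
p. 143 *"there exists a functorial algorithm for constructing `𝒟`- (respectively, `𝒟^⊢`-) prime-strips
from `ℱ`- (respectively, `ℱ^⊢`-) prime-strips"*; Definition 4.1 (iv) p. 96 *"to any `𝒟`-prime-strip
`†𝔇` one may associate, in a natural way, a `𝒟^⊢`-prime-strip `†𝔇^⊢` … the mono-analyticization"*;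
Remark 5.2.1 (ii) p. 143 (the compatibility `(𝔉 ↦ 𝔉^⊢ ↦ 𝔇^⊢) = (𝔉 ↦ 𝔇 ↦ 𝔇^⊢)`)
([IUTchI] Rmk 5.2.1 (i) p.143) [claim: Mochizuki2012, status: disputed].

The frozen interfaces `PMBaseKit.MultKit` (`PMBaseProcessions.lean`, field `monoMap`) and
`PMBaseKit.FKit` (`FPrimeStrips.lean`, fields `toDmMap`, `toDm_toFm`) record these algorithms on
isomorphisms as bare maps (`monoMap`, `toDmMap`) and the compatibility as a bare `Nonempty`; the
printed words "functorial" / "in a natural way" carry, in addition, the LAWS that these maps respect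
identities and composition and that the compatibility isomorphism is natural in the strip.  Consumers
in [IUTchIII] §1–2 (the `StripFrame` of `Literature/IUT/LogThetaLattice/`, merge-map row 46 / B10) need
exactly these laws.  Following the cell's kit rule they are packaged here as ONE hypothesis structure
`FKit.MonoLaws FK` over the frozen kits (no frozen file is touched), to be supplied by whoever
instantiates `FKit` from the local Frobenioids of [IUTchI] §3; the toy kits satisfy it (`MonoLaws.toy`,
consistency).  Nothing here is asserted about the intended model; no side is taken on [IUTchIII]
Cor. 3.12; typed ≠ discharged.
-/

namespace Literature.IUT.HodgeTheaters

open CategoryTheory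

universe u

namespace PMBaseKit

namespace FKit

variable {l : ℕ} {K : PMBaseKit.{u} l} {M : K.MultKit}

/-- **Functoriality laws of the mono-analyticization algorithms** `𝔇 ↦ 𝔇^⊢` ([IUTchI] Def 4.1 (iv)
p. 96, "in a natural way") and `𝔉^⊢ ↦ 𝔇^⊢` (Rmk 5.2.1 (i) p. 143, "functorial algorithm") on
isomorphisms, together with a CHOSEN compatibility isomorphism `(𝔉 ↦ 𝔉^⊢ ↦ 𝔇^⊢) ≅ (𝔉 ↦ 𝔇 ↦ 𝔇^⊢)`
(Rmk 5.2.1 (i), (ii)) natural in the `ℱ`-prime-strip — the laws the frozen kit fields `MultKit.monoMap`,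
`FKit.toDmMap`, `FKit.toDm_toFm` do not record.  Hypothesis structure (TODO-merge: supplied by the
instantiation of `FKit` from [IUTchI] §3, abc-iut-L5-t2 side).
([IUTchI] Rmk 5.2.1 (i) p.143) [claim: Mochizuki2012, status: disputed] -/
structure MonoLaws (FK : K.FKit M) where
  /-- `𝔉^⊢ ↦ 𝔇^⊢` respects identities -/
  toDmMap_refl : ∀ F : ∀ v, FK.FmAmb v, FK.toDmMap (fun v => Iso.refl (F v)) = 𝟙 (FK.toDm F)
  /-- `𝔉^⊢ ↦ 𝔇^⊢` respects composition -/
  toDmMap_trans : ∀ {F₁ F₂ F₃ : ∀ v, FK.FmAmb v} (φ : ∀ v, F₁ v ≅ F₂ v) (ψ : ∀ v, F₂ v ≅ F₃ v),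
    FK.toDmMap (fun v => φ v ≪≫ ψ v) = FK.toDmMap φ ≫ FK.toDmMap ψ
  /-- `𝔇 ↦ 𝔇^⊢` respects identities -/
  monoMap_refl : ∀ D : K.DStrip, M.monoMap (fun v => Iso.refl (D.obj v)) = 𝟙 (M.mono D)
  /-- `𝔇 ↦ 𝔇^⊢` respects composition -/
  monoMap_trans : ∀ {D₁ D₂ D₃ : K.DStrip} (φ : D₁.Iso D₂) (ψ : D₂.Iso D₃),
    M.monoMap (fun v => φ v ≪≫ ψ v) = M.monoMap φ ≫ M.monoMap ψ
  /-- the compatibility isomorphism `(‡𝔉^⊢)^{𝒟^⊢} ≅ (‡𝔇)^⊢` for an `ℱ`-prime-strip `‡𝔉`, CHOSEN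
  (the frozen field `toDm_toFm` only asserts `Nonempty`) -/
  toDmToFm : ∀ F : FK.FStrip, FK.toDm F.mono.obj ≅ M.mono F.assocD
  /-- … and natural in `‡𝔉`: for an isomorphism `φ : ¹𝔉 ⥲ ²𝔉` the square with `(φ^⊢)^{𝒟^⊢}` and
  `(φ^𝒟)^⊢` commutes -/
  toDmToFm_natural : ∀ {F₁ F₂ : FK.FStrip} (φ : F₁.Iso F₂),
    FK.toDmMap (fun v => (FK.toFm v).mapIso (φ v)) ≫ (toDmToFm F₂).hom =
      (toDmToFm F₁).hom ≫ M.monoMap (FStrip.assocDMap φ)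

namespace MonoLaws

variable {FK : K.FKit M}

/-- Under the laws, `𝔉^⊢ ↦ 𝔇^⊢` carries inverse isomorphisms to inverse morphisms.
([IUTchI] Rmk 5.2.1 (i) p.143) [claim: Mochizuki2012, status: disputed] -/
theorem toDmMap_symm_comp (L : FK.MonoLaws) {F₁ F₂ : ∀ v, FK.FmAmb v} (φ : ∀ v, F₁ v ≅ F₂ v) :
    FK.toDmMap (fun v => (φ v).symm) ≫ FK.toDmMap φ = 𝟙 _ := by
  rw [← L.toDmMap_trans]
  have : (fun v => (φ v).symm ≪≫ φ v) = fun v => Iso.refl (F₂ v) := by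
    funext v; ext; simp
  rw [this, L.toDmMap_refl]

/-- Under the laws, `𝔉^⊢ ↦ 𝔇^⊢` on isomorphisms is valued in isomorphisms of `𝒟^⊢`-prime-strips (the
mono-analytic base category is a groupoid, so this is automatic; recorded as the two-sided inverse).
([IUTchI] Rmk 5.2.1 (i) p.143) [claim: Mochizuki2012, status: disputed] -/
theorem toDmMap_comp_symm (L : FK.MonoLaws) {F₁ F₂ : ∀ v, FK.FmAmb v} (φ : ∀ v, F₁ v ≅ F₂ v) :
    FK.toDmMap φ ≫ FK.toDmMap (fun v => (φ v).symm) = 𝟙 _ := by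
  rw [← L.toDmMap_trans]
  have : (fun v => φ v ≪≫ (φ v).symm) = fun v => Iso.refl (F₁ v) := by
    funext v; ext; simp
  rw [this, L.toDmMap_refl]

/-- Under the laws, `𝔇 ↦ 𝔇^⊢` on isomorphisms is compatible with inverses.
([IUTchI] Def 4.1 (iv) p.96) [claim: Mochizuki2012, status: disputed] -/
theorem monoMap_symm_comp (L : FK.MonoLaws) {D₁ D₂ : K.DStrip} (φ : D₁.Iso D₂) :
    M.monoMap (fun v => (φ v).symm) ≫ M.monoMap φ = 𝟙 _ := by
  rw [← L.monoMap_trans]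
  have : (fun v => (φ v).symm ≪≫ φ v) = fun v => Iso.refl (D₂.obj v) := by
    funext v; ext; simp
  rw [this, L.monoMap_refl]

end MonoLaws

/-! ### Consistency: the toy kits satisfy the laws -/

/-- The toy `FKit` over `MultKit.toy` (one-object, one-morphism `𝒟^⊢`-category) satisfies `MonoLaws`:
all maps are identities of the unique object. ([IUTchI] Rmk 5.2.1 (i) p.143) [claim: Mochizuki2012, status: disputed] -/
noncomputable def MonoLaws.toy (l : ℕ) [Fact l.Prime] (hl : l ≠ 2) : (FKit.toy l hl).MonoLaws where
  toDmMap_refl _ := rfl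
  toDmMap_trans _ _ := rfl
  monoMap_refl _ := rfl
  monoMap_trans _ _ := rfl
  toDmToFm _ := Iso.refl _
  toDmToFm_natural _ := rfl

end FKit

end PMBaseKit

end Literature.IUT.HodgeTheaters
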